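import Summits.RiemannHypothesis.RiemannHypothesis.Theorems.TiltedLandingLaw421R3PurseHalf

/-! # law421 PURSE ½ — EXTRAS (sequel of `…R3PurseHalf`; C4 «kernel desk» rh-idea-6 g29)
SUPPORT module (fully proved, no `sorry`; `--supports … --as helper` only: proves no stub, no crux).  Director (CA391) RULING (2026-08-30T13:06Z):
RESTATE-α with κ = ½ — the successor crux `TiltedLandingLaw421R` = the 24774 text byte-for-byte with depth
`4 * hmax / s + (Hs / s) ^ 2 + B + 1 + ((B : ℝ) + 1) / 2` (kit of record `g9/rider94/half` ≡ C4 `g29/r11/half` ≡ desk `Rev11Expected_half`).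
`…R3PurseHalf` (the landing image b9c821a8) carries the four decls the registry needs (`halfPurse`, `law421Half_iff_text`, `restRateBotHalf_iff_text`,
`law421Half_of_succ_rate`); THIS FILE adds the BOOK-KEEPING the RATE^B books will read (the ½ EXTRA CAPITAL as a `Budget`, monotonicity from the typed
purse, the old stub texts paying the new ones):
* `halfBudget := fun … B => ((B : ℝ) + 1) / 2`; `halfPurse_eq_typed_add` / `_budget` (`rfl`); `halfBudget_pos`; `typedPurse_le_halfPurse`;
* `law421Half_of_typed : Law421P typedPurse → Law421P halfPurse`; `law421Half_of_succ_rateQ : RestSuccBotQ → RestRateBotQ → Law421P halfPurse`;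
  `restRateBotHalf_of_rateQ : RestRateBotQ → RestRateBotPQ halfPurse`; `halfPurse_nonneg_of_rate`.
With `…R3PurseNodes` (row 12): `extraQ halfPurse = halfBudget` and `residualBudgetPQ halfPurse aF aC = addBudget (residualBudgetQ aF aC) halfBudget`
are `residualBudgetPQ_eq_add` read at `P := halfPurse` (one `rfl`/`ring` line each, to be added there when RATE^B resumes).
K = bookkeeping; whether `RestRateBotPQ halfPurse` is TRUE is open analysis.  RH is NOT proved; 24774 OPEN (successor text pending rev 11). -/

namespace RhW08.PurseP

open Complex
open RhIdea6.G17.W07C7 RhIdea6.G17.W07C7.Rev6 RhIdea6.G18.W07C8.Law421BirthS RhIdea6.G19.W07C11.Seam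
open RhIdea6.G20.W07C12.Frac RhIdea6.G20.W07C12.StColP RhW07.C12.FieldSplit RhIdea6.G21.W07C13.TentMax
open RhW07.C14.TwoSided RhW07.C14.Classes RhW07.C14.Lineage RhW07.C14.Booking
open RhW07.C13.Heredity RhIdea6.G22.W07C15pre.Injection RhW07.E3.Cell
open RhW07.E3.Lit
open RhW08.Round1 RhW08.StSwap RhW08.Round2 RhW08.QuadW
open RhW08.SealSwap (PBot)
open RhW08.SealSwapQ

section HalfExtras

/-- the ½ EXTRA CAPITAL as a `Budget`: `(B + 1)/2` (director (CA391): void charge at coefficient ½). -/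
noncomputable def halfBudget : Budget := fun _ _ _ _ _ _ _ B => ((B : ℝ) + 1) / 2

/-- (K) `halfPurse = typedPurse + (B+1)/2` (definitional). -/
theorem halfPurse_eq_typed_add (f : ℂ → ℂ) (x₀ s hmax R Hs : ℝ) (B : ℕ) :
    halfPurse f x₀ s hmax R Hs B = typedPurse f x₀ s hmax R Hs B + ((B : ℝ) + 1) / 2 := rfl

/-- (K) … and `= typedPurse + halfBudget` read through any `η`. -/
theorem halfPurse_eq_typed_add_budget (η : ℝ) (f : ℂ → ℂ) (x₀ s hmax R Hs : ℝ) (B : ℕ) :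
    halfPurse f x₀ s hmax R Hs B = typedPurse f x₀ s hmax R Hs B + halfBudget η f x₀ s hmax R Hs B := rfl

/-- (K) the ½ extra capital is positive. -/
theorem halfBudget_pos (η : ℝ) (f : ℂ → ℂ) (x₀ s hmax R Hs : ℝ) (B : ℕ) : 0 < halfBudget η f x₀ s hmax R Hs B := by
  simp only [halfBudget]
  positivity

/-- (K) `typedPurse ≤ halfPurse` on every frame. -/
theorem typedPurse_le_halfPurse (f : ℂ → ℂ) (x₀ s hmax R Hs : ℝ) (B : ℕ) :
    typedPurse f x₀ s hmax R Hs B ≤ halfPurse f x₀ s hmax R Hs B := by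
  rw [halfPurse_eq_typed_add]
  have : (0 : ℝ) ≤ ((B : ℝ) + 1) / 2 := by positivity
  linarith

/-- (K) the typed law pays the ½ law (mono). -/
theorem law421Half_of_typed (h : Law421P typedPurse) : Law421P halfPurse :=
  law421P_mono (fun f x₀ s hmax R Hs B _ => typedPurse_le_halfPurse f x₀ s hmax R Hs B) h

/-- (K) the old (24774-keyed) composition still pays the ½ law: `RestSuccBotQ → RestRateBotQ → Law421P halfPurse`. -/
theorem law421Half_of_succ_rateQ (hS : RestSuccBotQ) (hR : RestRateBotQ) : Law421P halfPurse :=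
  law421Half_of_typed ((law421P_typed_iff).2 (law421T_of_succ_rateQ hS hR))

/-- (K) the old RATE stub text pays the new one: `RestRateBotQ → RestRateBotPQ halfPurse`. -/
theorem restRateBotHalf_of_rateQ (h : RestRateBotQ) : RestRateBotPQ halfPurse :=
  restRateBotPQ_mono (fun f x₀ s hmax R Hs B _ => typedPurse_le_halfPurse f x₀ s hmax R Hs B) (restRateBotPQ_of_rateQ h)

/-- (K) sanity: the ½ purse is at least `1/4` above the typed purse and positive under the RATE stub. -/
theorem halfPurse_nonneg_of_rate (h : RestRateBotPQ halfPurse) {η : ℝ} {f : ℂ → ℂ} {x₀ s hmax R Hs : ℝ} {B : ℕ}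
    (hE : EngineHyps5 2 η f x₀ s hmax R Hs B) : 0 ≤ halfPurse f x₀ s hmax R Hs B :=
  purse_nonneg_of_ratePQ h hE

end HalfExtras

end RhW08.PurseP
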